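import Mathlib.RingTheory.Ideal.Operations
import Mathlib.Algebra.Order.Floor.Ring
import Mathlib.Algebra.Order.Floor.Semiring
import Mathlib.Data.Rat.Floor
import Mathlib.Algebra.Ring.GeomSum
import Mathlib.Tactic.Ring
import Mathlib.Tactic.Positivity
import HarnessLib

/-!
# Crux `Steer` (stmt-ResolutionOfSingularities-16345), chain W4.1, β-LEAF (hK4′): the `β`-THRESHOLD IDEAL IS SHEAR-INVARIANT
# (idea-1's support debt `BetaGeShearInvariant`, CJS Lemma 13.6 «the column `a = α` keeps its initial forms» in ideal form;
# Theses-free, def-free research support)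

OURS (campaign `res-hironaka`, rung L ★L-G4, slot W4.1; statements about the route's own objects; they replace the
role of no printed item and are NOT statements of the manuscript under review [claim: Hironaka2017, status:
under-review]; AI review is weaker than expert review). Seat res-D-pv-003 (gen 6), K-β2♭ letter-law kernel owner
(res-L0-w41-plan-1 RULINGS 140/143). Statement = res-L0-w41-idea-1 g9 `Sketch-idea-1-v17-betaleaf.lean` §5
`BetaGeShearInvariant` with the `β`-threshold predicate `BetaGe` UNFOLDED (def-free: the ideal is written out; idea-1's
`BetaGe x y z w d α ρ f` is by definition `f ∈ betaThreshold …` below, so the words-level leaf is `Iff` by `rw`).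

## The ideal and the claim

For `x y z w : S`, `d : ℕ`, `α ρ : ℚ` the `β`-THRESHOLD IDEAL («`β ≥ ρ` on the column `a = α`» of the projected polygon
`Δ(f ; (z,w) ; (x,y))`, CJS Def. 11.1; idea-1 BETA-BLOCK-g9 §1) is

  `(z, w)^d + Σ_{i+j<d} ( (x^(⌊α(d−i−j)⌋+1) zⁱ wʲ) + (x^⌈α(d−i−j)⌉ · y^⌈ρ(d−i−j)⌉ zⁱ wʲ) )`.

**It does not change under the shear `y ↦ y − c·x`** (`betaThreshold_shear`): `yᵐ − (y − c x)ᵐ` is a multiple of `x`, and one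
more power of `x` on the column moves the monomial strictly to the right of the column, into the first summand
(`⌈α n⌉ + 1 ≥ ⌊α n⌋ + 1`). This is the ideal form of CJS Lemma 13.6 (the shear before a `(1:λ)`-letter keeps the left
column with its initial forms) used by the β-block lemma for the rational escape letters. No Theses file is imported;
nothing here is a route item or a registration. [cite: CossartJannsenSaito2020, Lemma 13.6] [folklore]
-/

noncomputable section

-- `Summit.<S>.<S>.…` duplicates the summit name by design (single-problem summit).
set_option linter.dupNamespace false

namespace Summit.ResolutionOfSingularities.ResolutionOfSingularities.Theorems.SwitchingDichotomy.BetaShear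

variable {S : Type*} [CommRing S]

/-- One column generator moves under the shear: `x^a · y^m · q ∈ (x^(a') · q) + (x^a · (y + c x)^m · q)` whenever `a' ≤ a + 1`
(`yᵐ − (y + c x)ᵐ ∈ (x)`). [folklore] -/
theorem pow_mul_pow_mul_mem_sup (x y c q : S) {a a' : ℕ} (m : ℕ) (ha : a' ≤ a + 1) :
    x ^ a * y ^ m * q ∈ Ideal.span ({x ^ a' * q} : Set S) ⊔ Ideal.span {x ^ a * (y + c * x) ^ m * q} := by
  obtain ⟨r, hr⟩ := sub_dvd_pow_sub_pow y (y + c * x) m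
  -- `y^m = (y + c x)^m + (y − (y + c x)) r = (y + c x)^m − c x r`
  have hy : y ^ m = (y + c * x) ^ m + (y - (y + c * x)) * r := by rw [← hr]; ring
  have hsplit : x ^ a * y ^ m * q = x ^ a * (y + c * x) ^ m * q + (-(c * r) * x ^ (a + 1 - a')) * (x ^ a' * q) := by
    have hx : x ^ (a + 1) = x ^ (a + 1 - a') * x ^ a' := by rw [← pow_add, Nat.sub_add_cancel ha]
    calc x ^ a * y ^ m * q = x ^ a * ((y + c * x) ^ m + (y - (y + c * x)) * r) * q := by rw [← hy]
      _ = x ^ a * (y + c * x) ^ m * q + (-(c * r)) * (x ^ (a + 1)) * q := by ring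
      _ = x ^ a * (y + c * x) ^ m * q + (-(c * r) * x ^ (a + 1 - a')) * (x ^ a' * q) := by rw [hx]; ring
  rw [hsplit]
  exact Ideal.add_mem _ (Ideal.mem_sup_right (Ideal.mem_span_singleton_self _))
    (Ideal.mem_sup_left (Ideal.mul_mem_left _ _ (Ideal.mem_span_singleton_self _)))

/-- The `β`-threshold ideal for the shifted variable contains the one for `y`: one inclusion of the shear invariance,
for an arbitrary shift `c`. [cite: CossartJannsenSaito2020, Lemma 13.6] -/
theorem betaThreshold_le_shear (x y z w c : S) (d : ℕ) (α ρ : ℚ) :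
    (Ideal.span {z, w} ^ d ⊔
      ⨆ (i : ℕ) (j : ℕ) (_ : i + j < d),
        (Ideal.span {x ^ (⌊α * ((d - i - j : ℕ) : ℚ)⌋₊ + 1) * z ^ i * w ^ j} ⊔
          Ideal.span {x ^ ⌈α * ((d - i - j : ℕ) : ℚ)⌉₊ * y ^ ⌈ρ * ((d - i - j : ℕ) : ℚ)⌉₊ * z ^ i * w ^ j})) ≤
    (Ideal.span {z, w} ^ d ⊔
      ⨆ (i : ℕ) (j : ℕ) (_ : i + j < d),
        (Ideal.span {x ^ (⌊α * ((d - i - j : ℕ) : ℚ)⌋₊ + 1) * z ^ i * w ^ j} ⊔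
          Ideal.span {x ^ ⌈α * ((d - i - j : ℕ) : ℚ)⌉₊ * (y + c * x) ^ ⌈ρ * ((d - i - j : ℕ) : ℚ)⌉₊ * z ^ i * w ^ j})) := by
  refine sup_le le_sup_left (iSup_le fun i => iSup_le fun j => iSup_le fun hij => ?_)
  refine le_trans ?_ (le_sup_right.trans' (le_iSup_of_le i (le_iSup_of_le j (le_iSup_of_le hij le_rfl))))
  refine sup_le le_sup_left ?_
  rw [Ideal.span_singleton_le_iff_mem]
  have h := pow_mul_pow_mul_mem_sup x y c (z ^ i * w ^ j) (a := ⌈α * ((d - i - j : ℕ) : ℚ)⌉₊)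
    (a' := ⌊α * ((d - i - j : ℕ) : ℚ)⌋₊ + 1) ⌈ρ * ((d - i - j : ℕ) : ℚ)⌉₊
    (Nat.succ_le_succ (Nat.floor_le_ceil _))
  have e1 : x ^ ⌈α * ((d - i - j : ℕ) : ℚ)⌉₊ * y ^ ⌈ρ * ((d - i - j : ℕ) : ℚ)⌉₊ * z ^ i * w ^ j =
      x ^ ⌈α * ((d - i - j : ℕ) : ℚ)⌉₊ * y ^ ⌈ρ * ((d - i - j : ℕ) : ℚ)⌉₊ * (z ^ i * w ^ j) := by ring
  have e2 : x ^ (⌊α * ((d - i - j : ℕ) : ℚ)⌋₊ + 1) * z ^ i * w ^ j =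
      x ^ (⌊α * ((d - i - j : ℕ) : ℚ)⌋₊ + 1) * (z ^ i * w ^ j) := by ring
  have e3 : x ^ ⌈α * ((d - i - j : ℕ) : ℚ)⌉₊ * (y + c * x) ^ ⌈ρ * ((d - i - j : ℕ) : ℚ)⌉₊ * z ^ i * w ^ j =
      x ^ ⌈α * ((d - i - j : ℕ) : ℚ)⌉₊ * (y + c * x) ^ ⌈ρ * ((d - i - j : ℕ) : ℚ)⌉₊ * (z ^ i * w ^ j) := by ring
  rw [e1, e2, e3]
  exact h

/-- **`betaThreshold_shear`** — idea-1's `BetaGeShearInvariant` in ideal form: the `β`-threshold ideal is INVARIANT under the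
shear `y ↦ y − c·x` (apply `betaThreshold_le_shear` with `c := -c` to `y`, and with `c` to `y − c x`).
[cite: CossartJannsenSaito2020, Lemma 13.6] -/
theorem betaThreshold_shear (x y z w c : S) (d : ℕ) (α ρ : ℚ) :
    (Ideal.span {z, w} ^ d ⊔
      ⨆ (i : ℕ) (j : ℕ) (_ : i + j < d),
        (Ideal.span {x ^ (⌊α * ((d - i - j : ℕ) : ℚ)⌋₊ + 1) * z ^ i * w ^ j} ⊔
          Ideal.span {x ^ ⌈α * ((d - i - j : ℕ) : ℚ)⌉₊ * y ^ ⌈ρ * ((d - i - j : ℕ) : ℚ)⌉₊ * z ^ i * w ^ j})) =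
    (Ideal.span {z, w} ^ d ⊔
      ⨆ (i : ℕ) (j : ℕ) (_ : i + j < d),
        (Ideal.span {x ^ (⌊α * ((d - i - j : ℕ) : ℚ)⌋₊ + 1) * z ^ i * w ^ j} ⊔
          Ideal.span {x ^ ⌈α * ((d - i - j : ℕ) : ℚ)⌉₊ * (y - c * x) ^ ⌈ρ * ((d - i - j : ℕ) : ℚ)⌉₊ * z ^ i * w ^ j})) := by
  apply le_antisymm
  · have h := betaThreshold_le_shear x y z w (-c) d α ρ
    have e : y + -c * x = y - c * x := by ring
    rw [e] at h
    exact h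
  · have h := betaThreshold_le_shear x (y - c * x) z w c d α ρ
    have e : y - c * x + c * x = y := by ring
    rw [e] at h
    exact h

/-- Membership form (idea-1's `BetaGeShearInvariant` VERBATIM up to unfolding `BetaGe`): for every `f`,
`f ∈ β-threshold(x, y, …) ↔ f ∈ β-threshold(x, y − c·x, …)`. [cite: CossartJannsenSaito2020, Lemma 13.6] -/
theorem mem_betaThreshold_iff_shear (x y z w c : S) (d : ℕ) (α ρ : ℚ) (f : S) :
    f ∈ (Ideal.span {z, w} ^ d ⊔
      ⨆ (i : ℕ) (j : ℕ) (_ : i + j < d),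
        (Ideal.span {x ^ (⌊α * ((d - i - j : ℕ) : ℚ)⌋₊ + 1) * z ^ i * w ^ j} ⊔
          Ideal.span {x ^ ⌈α * ((d - i - j : ℕ) : ℚ)⌉₊ * y ^ ⌈ρ * ((d - i - j : ℕ) : ℚ)⌉₊ * z ^ i * w ^ j})) ↔
    f ∈ (Ideal.span {z, w} ^ d ⊔
      ⨆ (i : ℕ) (j : ℕ) (_ : i + j < d),
        (Ideal.span {x ^ (⌊α * ((d - i - j : ℕ) : ℚ)⌋₊ + 1) * z ^ i * w ^ j} ⊔
          Ideal.span {x ^ ⌈α * ((d - i - j : ℕ) : ℚ)⌉₊ * (y - c * x) ^ ⌈ρ * ((d - i - j : ℕ) : ℚ)⌉₊ * z ^ i * w ^ j})) := by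
  rw [betaThreshold_shear x y z w c d α ρ]

end Summit.ResolutionOfSingularities.ResolutionOfSingularities.Theorems.SwitchingDichotomy.BetaShear

end
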